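import Mathlib
import Summits.AtomisticToContinuum.HydrodynamicLimit.Theorems.ImplosionDichotomyDenseExcursionSonicCavityDefs

/-!
# An effective Levinson lemma for `2 × 2` systems (inter-family conversion is `O(1/|q|)`)
# (crux `DenseExcursion`, line `sonic-cavity-renewal`, brick for stub `stub_sonicConfinement`)

Helper file (`--supports stmt-AtomisticToContinuum-12586`, line lead a2, stub-worker for `stub_sonicConfinement`).

The `|Im Λ|`-confinement mechanism (idea card, TRIAGE-r2-1 (ii)) needs, on the bulk `[x_c, −δ]` of the core where the two
characteristic speeds `c± = (W − 1) ± S` are distinct and non-zero, that a solution of the mode ODE which is (almost) purely of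
one characteristic family at one end stays so up to an error `O(1/|Λ|)` — the content of Levinson's asymptotic diagonalisation
theorem (Coppel 1965 Ch. IV; Eastham 1989 Thm 1.3.1), but with EXPLICIT constants. For `2 × 2` systems one integration by
parts suffices, and the integration by parts can be done at the level of derivatives (mean value inequality, no integrals):

Write the mode system in the characteristic amplitudes with the phase of the dominant (`−`) family factored out,
`u = e^{−θ₋} m`, `w = e^{−θ₋} p` (`θ₋′ = (Λ − b₋₋)/c₋`). Then
  `u′ = α w`, `w′ = q w + β u`, `q = (Λ − b₊₊)/c₊ − (Λ − b₋₋)/c₋`, `α = −b₋₊/c₋`, `β = −b₊₋/c₊`,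
with `|q| ≥ |Im Λ| (1/c₊ + 1/|c₋|)` LARGE and `α, β, (β/q)′` bounded. This file proves, for any such abstract system on `[a, b]`:

* `levinson_slow_bound`: `‖u x − u a‖ ≤ A V (x − a)` (`‖α‖ ≤ A`, `‖w‖ ≤ V`);
* `levinson_fast_bound` (registered helper): with `Q′ = q`, `Re (Q x − Q y) ≤ K` for `y ≤ x` (Levinson's dichotomy bound, trivial on a
  compact interval with `K = (b − a) sup |Re q|`, which is `Im Λ`-independent), `ω ≤ |q|`, `‖β‖ ≤ B`, `‖(β/q)′‖ ≤ L`, `‖u‖ ≤ U`, `‖w‖ ≤ V`: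
  `‖w x − e^{Q x − Q a} w a‖ ≤ (1 + e^K)(B/ω) U + e^K (L U + (B/ω) A V)(x − a)`.
  Proof: `G(y) = e^{Q x − Q y}(w + (β/q) u)(y)` has `G′ = e^{Q x − Q y}((β/q)′ u + (β/q) α w)` — the `O(1)` terms cancel — and the mean
  value inequality on `[a, x]` bounds `G x − G a`;
* `levinson_conversion`: if moreover `e^K (B/ω) A (b − a) ≤ 1/2`, then `sup ‖w‖ ≤ 2 (e^K ‖w a‖ + ((1 + e^K) B/ω + e^K L (b − a)) U)`
  (bootstrap at the point where `‖w‖` is maximal): a solution entering `[a, b]` purely in the slow family (`w a = 0`) acquires a fast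
  component of relative size `O(B/ω + L) = O(1/|Im Λ|)` only.

Sources: Coppel 1965 "Stability and Asymptotic Behavior of Differential Equations" Ch. IV; Eastham 1989 "The Asymptotic Solution of
Linear Differential Systems" Thm 1.3.1 (proved here from Mathlib's mean value inequality; no citation is load-bearing).
NOT here: the sonic-point and centre local analyses of `stub_sonicConfinement` (see the worker report).
-/

noncomputable section

open Set

namespace Summit.AtomisticToContinuum.HydrodynamicLimit.Theorems.SonicCavityRenewal

/-- SLOW COMPONENT: if `u′ = α w` on `[a, b]` with `‖α‖ ≤ A`, `‖w‖ ≤ V`, then `‖u x − u a‖ ≤ A V (x − a)` (mean value inequality).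
[folklore] -/
theorem levinson_slow_bound {a b : ℝ} {u w α : ℝ → ℂ} {A V : ℝ}
    (hu : ∀ x ∈ Icc a b, HasDerivAt u (α x * w x) x)
    (hα : ∀ x ∈ Icc a b, ‖α x‖ ≤ A) (hV : ∀ x ∈ Icc a b, ‖w x‖ ≤ V) :
    ∀ x ∈ Icc a b, ‖u x - u a‖ ≤ A * V * (x - a) := by
  refine norm_image_sub_le_of_norm_deriv_le_segment' (fun x hx => (hu x hx).hasDerivWithinAt) ?_
  intro x hx
  have hx' : x ∈ Icc a b := Ico_subset_Icc_self hx
  have hA : 0 ≤ A := (norm_nonneg _).trans (hα x hx')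
  calc ‖α x * w x‖ = ‖α x‖ * ‖w x‖ := norm_mul _ _
    _ ≤ A * V := mul_le_mul (hα x hx') (hV x hx') (norm_nonneg _) hA

/-- **EFFECTIVE LEVINSON LEMMA (`2 × 2`, fast component)** — registered helper `levinson_fast_bound` for `stub_sonicConfinement`.
For the triangular-interaction system `u′ = α w`, `w′ = q w + β u` on `[a, b]` with a primitive `Q′ = q`, the one-sided
dichotomy bound `Re (Q x − Q y) ≤ K` (`a ≤ y ≤ x ≤ b`), `0 < ω ≤ |q|`, `‖α‖ ≤ A`, `‖β‖ ≤ B`, `‖(β/q)′‖ ≤ L`, `‖u‖ ≤ U`, `‖w‖ ≤ V`: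
`‖w x − e^{Q x − Q a} w a‖ ≤ (1 + e^K)(B/ω)U + e^K (L U + (B/ω) A V)(x − a)` — every term on the right carries the small factor
`B/ω` or `L` (both `O(1/|Im Λ|)` for the mode system). One integration by parts, performed on
`G(y) = e^{Q x − Q y}(w y + (β y/q y) u y)`, whose derivative `e^{Q x − Q y}((β/q)′ u + (β/q) α w)` has no `O(1)` term.
[folklore] -/
theorem levinson_fast_bound : ∀ (a b : ℝ) (u w α β q Q ρ' : ℝ → ℂ) (A B ω K L U V : ℝ), (∀ x ∈ Set.Icc a b, HasDerivAt u (α x * w x) x) → (∀ x ∈ Set.Icc a b, HasDerivAt w (q x * w x + β x * u x) x) → (∀ x ∈ Set.Icc a b, HasDerivAt Q (q x) x) → (∀ x ∈ Set.Icc a b, HasDerivAt (fun y => β y / q y) (ρ' x) x) → 0 < ω → (∀ x ∈ Set.Icc a b, ω ≤ ‖q x‖) → (∀ x ∈ Set.Icc a b, ‖α x‖ ≤ A) → (∀ x ∈ Set.Icc a b, ‖β x‖ ≤ B) → (∀ x ∈ Set.Icc a b, ∀ y ∈ Set.Icc a x, (Q x - Q y).re ≤ K) → (∀ x ∈ Set.Icc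 a b, ‖ρ' x‖ ≤ L) → (∀ x ∈ Set.Icc a b, ‖u x‖ ≤ U) → (∀ x ∈ Set.Icc a b, ‖w x‖ ≤ V) → ∀ x ∈ Set.Icc a b, ‖w x - Complex.exp (Q x - Q a) * w a‖ ≤ (1 + Real.exp K) * (B / ω * U) + Real.exp K * (L * U + B / ω * (A * V)) * (x - a) := by
  intro a b u w α β q Q ρ' A B ω K L U V hu hw hQ hρ hω hq hα hβ hK hL hU hV x hx
  -- signs
  have hU0 : 0 ≤ U := (norm_nonneg _).trans (hU x hx)
  have hV0 : 0 ≤ V := (norm_nonneg _).trans (hV x hx)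
  have hA0 : 0 ≤ A := (norm_nonneg _).trans (hα x hx)
  have hB0 : 0 ≤ B := (norm_nonneg _).trans (hβ x hx)
  have hL0 : 0 ≤ L := (norm_nonneg _).trans (hL x hx)
  have hqne : ∀ y ∈ Icc a b, q y ≠ 0 := by
    intro y hy h
    have := hq y hy
    rw [h, norm_zero] at this
    linarith
  -- the two pointwise quotient bounds
  have hβq : ∀ y ∈ Icc a b, ‖β y / q y‖ ≤ B / ω := by
    intro y hy
    rw [norm_div]
    exact div_le_div₀ hB0 (hβ y hy) hω (hq y hy)
  have hexpK : ∀ y ∈ Icc a x, ‖Complex.exp (Q x - Q y)‖ ≤ Real.exp K := by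
    intro y hy
    rw [Complex.norm_exp]
    exact Real.exp_le_exp.2 (hK x hx y hy)
  -- the gauge function `G` and its derivative (the O(1) terms cancel)
  set G : ℝ → ℂ := fun y => Complex.exp (Q x - Q y) * (w y + β y / q y * u y) with hG
  have hGd : ∀ y ∈ Icc a x,
      HasDerivAt G (Complex.exp (Q x - Q y) * (ρ' y * u y + β y / q y * (α y * w y))) y := by
    intro y hy
    have hy' : y ∈ Icc a b := ⟨hy.1, hy.2.trans hx.2⟩
    have h1 : HasDerivAt (fun z => Complex.exp (Q x - Q z)) (Complex.exp (Q x - Q y) * (0 - q y)) y :=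
      ((hasDerivAt_const y (Q x)).sub (hQ y hy')).cexp
    have h2 : HasDerivAt (fun z => w z + β z / q z * u z)
        (q y * w y + β y * u y + (ρ' y * u y + β y / q y * (α y * w y))) y :=
      (hw y hy').add ((hρ y hy').mul (hu y hy'))
    have hβq' : β y / q y * q y = β y := div_mul_cancel₀ (β y) (hqne y hy')
    refine (h1.mul h2).congr_deriv ?_
    linear_combination (-(Complex.exp (Q x - Q y) * u y)) * hβq'
  -- mean value inequality on `[a, x]`
  have hbound : ∀ y ∈ Ico a x,
      ‖Complex.exp (Q x - Q y) * (ρ' y * u y + β y / q y * (α y * w y))‖ ≤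
        Real.exp K * (L * U + B / ω * (A * V)) := by
    intro y hy
    have hy₁ : y ∈ Icc a x := Ico_subset_Icc_self hy
    have hy' : y ∈ Icc a b := ⟨hy.1, hy.2.le.trans hx.2⟩
    calc ‖Complex.exp (Q x - Q y) * (ρ' y * u y + β y / q y * (α y * w y))‖
        ≤ ‖Complex.exp (Q x - Q y)‖ * (‖ρ' y‖ * ‖u y‖ + ‖β y / q y‖ * (‖α y‖ * ‖w y‖)) := by
          rw [norm_mul]
          gcongr
          refine (norm_add_le _ _).trans ?_
          rw [norm_mul, norm_mul, norm_mul]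
      _ ≤ Real.exp K * (L * U + B / ω * (A * V)) := by
          have h3 : ‖ρ' y‖ * ‖u y‖ ≤ L * U :=
            mul_le_mul (hL y hy') (hU y hy') (norm_nonneg _) hL0
          have h4 : ‖β y / q y‖ * (‖α y‖ * ‖w y‖) ≤ B / ω * (A * V) :=
            mul_le_mul (hβq y hy') (mul_le_mul (hα y hy') (hV y hy') (norm_nonneg _) hA0)
              (by positivity) (by positivity)
          exact mul_le_mul (hexpK y hy₁) (add_le_add h3 h4) (by positivity) (by positivity)
  have hMVT := norm_image_sub_le_of_norm_deriv_le_segment' (f := G) (a := a) (b := x)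
    (fun y hy => (hGd y hy).hasDerivWithinAt) hbound x (right_mem_Icc.2 hx.1)
  -- unpack `G x`, `G a`
  have key : w x - Complex.exp (Q x - Q a) * w a =
      (G x - G a) - β x / q x * u x + Complex.exp (Q x - Q a) * (β a / q a * u a) := by
    simp only [hG]
    rw [sub_self, Complex.exp_zero]
    ring
  have h5 : ‖β x / q x * u x‖ ≤ B / ω * U := by
    rw [norm_mul]
    exact mul_le_mul (hβq x hx) (hU x hx) (norm_nonneg _) (by positivity)
  have h6 : ‖Complex.exp (Q x - Q a) * (β a / q a * u a)‖ ≤ Real.exp K * (B / ω * U) := by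
    have ha : a ∈ Icc a b := left_mem_Icc.2 (hx.1.trans hx.2)
    rw [norm_mul, norm_mul]
    exact mul_le_mul (hexpK a (left_mem_Icc.2 hx.1))
      (mul_le_mul (hβq a ha) (hU a ha) (norm_nonneg _) (by positivity)) (by positivity) (by positivity)
  calc ‖w x - Complex.exp (Q x - Q a) * w a‖
      = ‖(G x - G a) - β x / q x * u x + Complex.exp (Q x - Q a) * (β a / q a * u a)‖ := by rw [key]
    _ ≤ ‖G x - G a‖ + ‖β x / q x * u x‖ + ‖Complex.exp (Q x - Q a) * (β a / q a * u a)‖ :=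
        (norm_add_le _ _).trans (by gcongr; exact norm_sub_le _ _)
    _ ≤ Real.exp K * (L * U + B / ω * (A * V)) * (x - a) + B / ω * U + Real.exp K * (B / ω * U) :=
        add_le_add (add_le_add hMVT h5) h6
    _ = (1 + Real.exp K) * (B / ω * U) + Real.exp K * (L * U + B / ω * (A * V)) * (x - a) := by ring

/-- **CONVERSION BOUND** (the form the confinement argument consumes). Under the hypotheses of `levinson_fast_bound` WITHOUT an a
priori bound on `w`, if the interval is short relative to the coupling, `e^K (B/ω) A (b − a) ≤ 1/2`, then on all of `[a, b]`
`‖w x‖ ≤ 2 (e^K ‖w a‖ + ((1 + e^K)(B/ω) + e^K L (b − a)) U)`: bootstrap `levinson_fast_bound` at a point where the continuous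
function `‖w‖` attains its maximum on the compact interval. In the mode system every coefficient of `U` is `O(1/|Im Λ|)`: a solution
that is purely of the slow family at `a` (`w a = 0`) carries a fast component of relative size `O(1/|Im Λ|)` throughout. [folklore] -/
theorem levinson_conversion {a b : ℝ} (hab : a ≤ b) {u w α β q Q ρ' : ℝ → ℂ} {A B ω K L U : ℝ}
    (hu : ∀ x ∈ Icc a b, HasDerivAt u (α x * w x) x)
    (hw : ∀ x ∈ Icc a b, HasDerivAt w (q x * w x + β x * u x) x)
    (hQ : ∀ x ∈ Icc a b, HasDerivAt Q (q x) x)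
    (hρ : ∀ x ∈ Icc a b, HasDerivAt (fun y => β y / q y) (ρ' x) x)
    (hω : 0 < ω) (hq : ∀ x ∈ Icc a b, ω ≤ ‖q x‖)
    (hα : ∀ x ∈ Icc a b, ‖α x‖ ≤ A) (hβ : ∀ x ∈ Icc a b, ‖β x‖ ≤ B)
    (hK : ∀ x ∈ Icc a b, ∀ y ∈ Icc a x, (Q x - Q y).re ≤ K)
    (hL : ∀ x ∈ Icc a b, ‖ρ' x‖ ≤ L) (hU : ∀ x ∈ Icc a b, ‖u x‖ ≤ U)
    (hθ : Real.exp K * (B / ω * A) * (b - a) ≤ 1 / 2) :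
    ∀ x ∈ Icc a b, ‖w x‖ ≤
      2 * (Real.exp K * ‖w a‖ + ((1 + Real.exp K) * (B / ω) + Real.exp K * L * (b - a)) * U) := by
  -- `‖w‖` attains its maximum `V` on the compact interval
  have hcont : ContinuousOn (fun x => ‖w x‖) (Icc a b) :=
    continuous_norm.comp_continuousOn fun x hx => (hw x hx).continuousAt.continuousWithinAt
  obtain ⟨x₀, hx₀, hmax⟩ := isCompact_Icc.exists_isMaxOn (nonempty_Icc.2 hab) hcont
  set V := ‖w x₀‖ with hVdef
  have hV : ∀ x ∈ Icc a b, ‖w x‖ ≤ V := fun x hx => hmax hx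
  have ha : a ∈ Icc a b := left_mem_Icc.2 hab
  have hU0 : 0 ≤ U := (norm_nonneg _).trans (hU a ha)
  have hV0 : 0 ≤ V := norm_nonneg _
  have hA0 : 0 ≤ A := (norm_nonneg _).trans (hα a ha)
  have hB0 : 0 ≤ B := (norm_nonneg _).trans (hβ a ha)
  have hL0 : 0 ≤ L := (norm_nonneg _).trans (hL a ha)
  -- the fast bound at the maximum point
  have hfast := levinson_fast_bound a b u w α β q Q ρ' A B ω K L U V hu hw hQ hρ hω hq hα hβ hK hL hU hV x₀ hx₀
  have hexp : ‖Complex.exp (Q x₀ - Q a) * w a‖ ≤ Real.exp K * ‖w a‖ := by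
    rw [norm_mul, Complex.norm_exp]
    exact mul_le_mul_of_nonneg_right (Real.exp_le_exp.2 (hK x₀ hx₀ a (left_mem_Icc.2 hx₀.1))) (norm_nonneg _)
  have hlen : x₀ - a ≤ b - a := by linarith [hx₀.2]
  have hVle : V ≤ Real.exp K * ‖w a‖ + ((1 + Real.exp K) * (B / ω) + Real.exp K * L * (b - a)) * U + V / 2 := by
    have h1 : V ≤ ‖Complex.exp (Q x₀ - Q a) * w a‖ + ‖w x₀ - Complex.exp (Q x₀ - Q a) * w a‖ := by
      rw [hVdef]
      exact norm_le_norm_add_norm_sub' _ _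
    have h2 : Real.exp K * (L * U + B / ω * (A * V)) * (x₀ - a) ≤
        Real.exp K * (L * U + B / ω * (A * V)) * (b - a) :=
      mul_le_mul_of_nonneg_left hlen (by positivity)
    have h3 : Real.exp K * (L * U + B / ω * (A * V)) * (b - a) =
        Real.exp K * L * (b - a) * U + Real.exp K * (B / ω * A) * (b - a) * V := by ring
    have h4 : Real.exp K * (B / ω * A) * (b - a) * V ≤ 1 / 2 * V := mul_le_mul_of_nonneg_right hθ hV0
    nlinarith [h1, hexp, hfast, h2, h3, h4]
  intro x hx
  have := hV x hx
  nlinarith [hVle, this]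

end Summit.AtomisticToContinuum.HydrodynamicLimit.Theorems.SonicCavityRenewal

end
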